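import Literature.Topology.FourManifolds.TrisectionsImplantModel
import HarnessLib

/-!
# The implant model, with the face data exported

Topic `Literature/Topology/FourManifolds`; infrastructure for the fact seat
`provefact-Literature.Topology.FourManifolds.exists-14560f9fc8` (named fact (c′)
`Literature.Topology.FourManifolds.exists_stabilized_gkTrisection`, Gay–Kirby 2016, Def. 8 and
Lemma 10).  Everything in this file is **proved**; no definitions, no named facts.

`Implant.exists_implant₂` is `Implant.exists_implant` (`TrisectionsImplantModel.lean`, same
construction, same proof from the same lemmas) with, in addition, the data needed to follow the
three **faces** of the trisection through the implant: the recentred birth function `N` on `ℝ³`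
(Morse, equal to the coordinate `z₀` off a compact `K`, critical set a birth pair `{z₀, z₁}` of
indices `1, 2` with `N z₀ < 0 < N z₁`), the slab half-width `P₀`, the **slab formula**
`(ũ, ṽ) = ((x₃ - N z)/2, (-x₃ - N z)/2)` for `|x₃| ≤ P₀` (`z = dropLast x`), the estimate
`|x₀| + |N z - x₀| < P₀` over `K` and its consequence that the face points `{ũ = 0}`,
`{ṽ = 0}` over `K` lie in the open slab — so that over `K` the model faces are the graphs
`x₃ = ± N z` (and `x₃ = 0`) of the birth function, which gain exactly one critical point each
(Gay–Kirby 2016, proof of Lemma 10; Milnor 1965, Lemma 8.2).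

## References

* D. Gay, R. Kirby, *Trisecting 4-manifolds*, Geom. Topol. 20 (2016) 3097–3132, Def. 8,
  Lemma 10. [GayKirby2016]
* J. Milnor, *Lectures on the h-cobordism theorem* (1965), Lemma 8.2. [MilnorHCobordism1965]
-/

open scoped Manifold ContDiff Topology
open Set Function Filter Metric

noncomputable section

namespace Literature.Topology.FourManifolds

namespace Implant

open MorseBirth

/-- **The implant with face data.**  See `exists_implant` and the module docstring.
[cite: GayKirby2016, Def. 8 and proof of Lemma 10; MilnorHCobordism1965, Lemma 8.2] -/
theorem exists_implant₂ (qs : EuclideanSpace ℝ (Fin 4)) (hqs0 : qs 0 = 0) (hqs3 : qs 3 = 0)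
    {R : ℝ} (hR : 0 < R) :
    ∃ (uN vN : EuclideanSpace ℝ (Fin 4) → ℝ) (xs : EuclideanSpace ℝ (Fin 4)),
      ContDiff ℝ ∞ uN ∧ ContDiff ℝ ∞ vN ∧ (∀ x, uN x - vN x = x 3) ∧
      (∃ Kb : Set (EuclideanSpace ℝ (Fin 4)), IsCompact Kb ∧ Kb ⊆ ball qs R ∧
        ∀ x ∉ Kb, uN x = (x 3 - x 0) / 2 ∧ vN x = (-x 3 - x 0) / 2) ∧
      (∀ x, 0 < fderiv ℝ uN x (EuclideanSpace.single 3 1)) ∧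
      (∀ x, fderiv ℝ vN x (EuclideanSpace.single 3 1) < 0) ∧
      (∀ x, uN x = 0 → vN x = 0 →
        ∃ Ψ : OpenPartialHomeomorph (EuclideanSpace ℝ (Fin 4)) (EuclideanSpace ℝ (Fin 4)),
          x ∈ Ψ.source ∧ ContDiffOn ℝ ∞ Ψ Ψ.source ∧ ContDiffOn ℝ ∞ Ψ.symm Ψ.target ∧
          ∀ y ∈ Ψ.source, Ψ y 0 = uN y ∧ Ψ y 1 = vN y) ∧
      xs ∈ ball qs R ∧ 0 < uN xs ∧ 0 < vN xs ∧
      IsMCriticalPt (𝓡 4) (fun x => -(uN x * vN x)) xs ∧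
      (mhessian (𝓡 4) (fun x => -(uN x * vN x)) xs).Nondegenerate ∧
      morseIndex (𝓡 4) (fun x => -(uN x * vN x)) xs = 1 ∧
      (∀ x, 0 < uN x → 0 < vN x → IsMCriticalPt (𝓡 4) (fun x => -(uN x * vN x)) x → x = xs) ∧
      (∀ x, 0 < vN x - uN x → 0 < -uN x →
        ¬ IsMCriticalPt (𝓡 4) (fun x => -((vN x - uN x) * (-uN x))) x) ∧
      (∀ x, 0 < -vN x → 0 < uN x - vN x →
        ¬ IsMCriticalPt (𝓡 4) (fun x => -((-vN x) * (uN x - vN x))) x) ∧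
      -- regularity at the face points of the three wedges
      (∀ x, uN x = 0 → 0 < vN x → ¬ IsMCriticalPt (𝓡 4) (fun x => -(uN x * vN x)) x) ∧
      (∀ x, vN x = 0 → 0 < uN x → ¬ IsMCriticalPt (𝓡 4) (fun x => -(uN x * vN x)) x) ∧
      (∀ x, vN x - uN x = 0 → 0 < -uN x →
        ¬ IsMCriticalPt (𝓡 4) (fun x => -((vN x - uN x) * (-uN x))) x) ∧
      (∀ x, -uN x = 0 → 0 < vN x - uN x →
        ¬ IsMCriticalPt (𝓡 4) (fun x => -((vN x - uN x) * (-uN x))) x) ∧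
      (∀ x, -vN x = 0 → 0 < uN x - vN x →
        ¬ IsMCriticalPt (𝓡 4) (fun x => -((-vN x) * (uN x - vN x))) x) ∧
      (∀ x, uN x - vN x = 0 → 0 < -vN x →
        ¬ IsMCriticalPt (𝓡 4) (fun x => -((-vN x) * (uN x - vN x))) x) ∧
      -- the face data: the birth function and the slab
      (∃ (N : EuclideanSpace ℝ (Fin 3) → ℝ) (K : Set (EuclideanSpace ℝ (Fin 3))) (P₀ : ℝ)
          (z₀ z₁ : EuclideanSpace ℝ (Fin 3)),
        0 < P₀ ∧ IsCompact K ∧ IsMorse (𝓡 3) N ∧ (∀ z ∉ K, N z = z 0) ∧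
        criticalSet (𝓡 3) N = {z₀, z₁} ∧ z₀ ≠ z₁ ∧ morseIndex (𝓡 3) N z₀ = 1 ∧
        morseIndex (𝓡 3) N z₁ = 2 ∧ N z₀ < 0 ∧ 0 < N z₁ ∧ dropLast 2 xs = z₀ ∧ xs 3 = 0 ∧
        (∀ x, |x 3| ≤ P₀ → uN x = (x 3 - N (dropLast 2 x)) / 2 ∧ vN x = (-x 3 - N (dropLast 2 x)) / 2) ∧
        (∀ x, dropLast 2 x ∈ K → |x 0| + |N (dropLast 2 x) - x 0| < P₀) ∧
        (∀ x, uN x = 0 ∨ vN x = 0 → dropLast 2 x ∈ K → |x 3| < P₀) ∧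
        (∀ x, |N (dropLast 2 x)| < P₀ → dropLast 2 x ∈ K → snocEquiv 3 (dropLast 2 x, N (dropLast 2 x)) ∈ ball qs R)) := by
  -- ### parameters
  obtain ⟨C, hC0, hC⟩ := exists_bound_deriv_θ
  set P₀ : ℝ := R / 4 with hP₀def
  have hP₀ : 0 < P₀ := by positivity
  set r : ℝ := R / 8 with hrdef
  have hr : 0 < r := by positivity
  set ε : ℝ := min (R / 16) (R / (8 * (C + 1))) with hεdef
  have hε : 0 < ε := lt_min (by positivity) (by positivity)
  have hε1 : ε ≤ R / 16 := min_le_left _ _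
  have hCε : C * ε < R / 8 := by
    have h1 : C * ε ≤ C * (R / (8 * (C + 1))) := mul_le_mul_of_nonneg_left (min_le_right _ _) hC0
    have h2 : C * (R / (8 * (C + 1))) < R / 8 := by
      rw [mul_div_assoc', div_lt_div_iff₀ (by positivity) (by positivity)]
      nlinarith
    linarith
  have hpar1 : C * ε < P₀ := by rw [hP₀def]; linarith
  have hpar2 : (r + ε) * C * ε < P₀ ^ 2 := by
    have h1 : r + ε ≤ 3 * R / 16 := by rw [hrdef]; linarith
    have h2 : (r + ε) * (C * ε) ≤ 3 * R / 16 * (C * ε) :=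
      mul_le_mul_of_nonneg_right h1 (mul_nonneg hC0 hε.le)
    have h3 : 3 * R / 16 * (C * ε) < 3 * R / 16 * (R / 8) := mul_lt_mul_of_pos_left hCε (by positivity)
    rw [hP₀def]
    nlinarith
  have hpar3 : r + ε + 3 / 2 * C * ε < 2 * P₀ := by rw [hrdef, hP₀def]; nlinarith
  have hrR : r ^ 2 + (3 / 2 * P₀) ^ 2 < R ^ 2 := by rw [hrdef, hP₀def]; nlinarith
  -- ### the birth function and the model functions
  obtain ⟨N, hN, ⟨K, hK, hKball, hNK⟩, hεN, z₀, z₁, hz₀₁, hcrit, hi₀, hi₁, hNz₀, hNz₁⟩ :=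
    exists_birth_recentred (dropLast 2 qs) (by rw [dropLast_two_apply_zero, hqs0]) hr hε
  have hNs : ContDiff ℝ ∞ N := contMDiff_iff_contDiff.1 hN.1
  set M : EuclideanSpace ℝ (Fin 3) → ℝ := fun z => N z - z 0 with hMdef'
  have hMdef : ∀ z, M z = N z - z 0 := fun z => rfl
  have hMs := contDiff_M hNs hMdef
  set nN : EuclideanSpace ℝ (Fin 4) → ℝ := fun x => x 0 + θR P₀ (x 3) * M (dropLast 2 x) with hnN'
  have hnN : ∀ x, nN x = x 0 + θR P₀ (x 3) * M (dropLast 2 x) := fun x => rfl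
  set uN : EuclideanSpace ℝ (Fin 4) → ℝ := fun x => (x 3 - nN x) / 2 with huN'
  have huN : ∀ x, uN x = (x 3 - nN x) / 2 := fun x => rfl
  set vN : EuclideanSpace ℝ (Fin 4) → ℝ := fun x => (-x 3 - nN x) / 2 with hvN'
  have hvN : ∀ x, vN x = (-x 3 - nN x) / 2 := fun x => rfl
  set q : EuclideanSpace ℝ (Fin 4) → ℝ := fun x => -(uN x * vN x) with hq'
  have hq : ∀ x, q x = (x 3 ^ 2 - nN x ^ 2) / 4 := fun x => by
    show -(uN x * vN x) = _; rw [huN, hvN]; ring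
  set xs : EuclideanSpace ℝ (Fin 4) := snocEquiv 3 (z₀, 0) with hxsdef
  have hxs : dropLast 2 xs = z₀ := dropLast_snocEquiv 2 z₀ 0
  have hxs3 : xs 3 = 0 := snocEquiv_apply_last 3 (z₀, 0)
  obtain ⟨huNs, hvNs⟩ := contDiff_uN_vN hMs hnN huN hvN
  -- ### the critical point
  obtain ⟨huxs, hvxs, hcritxs, -⟩ := crit_xs hNs hMdef hcrit hNz₀ hP₀ hnN huN hvN hq hxs hxs3
  obtain ⟨hnd, hidx⟩ := morseData_q_xs hN hMdef hP₀ hcrit hi₀ hNz₀ hnN hq hxs hxs3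
  have hz₀K : z₀ ∈ K := mem_of_isMCriticalPt_of_eq_coord hK.isClosed hNK
    (by rw [← mem_criticalSet (I := 𝓡 3), hcrit]; exact mem_insert _ _)
  have hxsball : xs ∈ ball qs R := by
    rw [mem_ball, dist_eq_norm]
    have h1 : dist z₀ (dropLast 2 qs) < r := hKball hz₀K
    rw [dist_eq_norm] at h1
    have h2 := norm_sq_eq_dropLast (xs - qs)
    rw [PiLp.sub_apply, hqs3, hxs3, sub_zero, dropLast_sub, hxs] at h2
    have h3 : ‖z₀ - dropLast 2 qs‖ ^ 2 < r ^ 2 := pow_lt_pow_left₀ h1 (norm_nonneg _) two_ne_zero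
    have h4 : ‖xs - qs‖ ^ 2 < R ^ 2 := by
      rw [h2]
      have : r ^ 2 ≤ R ^ 2 := by rw [hrdef]; nlinarith
      nlinarith
    exact lt_of_pow_lt_pow_left₀ 2 hR.le h4
  -- ### the box
  obtain ⟨hKbc, hKbball⟩ := isCompact_box hK hqs3 hKball hrR hR
  refine ⟨uN, vN, xs, huNs, hvNs, fun x => (uN_sub_vN huN hvN x).1,
    ⟨{y | |y 3| ≤ 3 / 2 * P₀ ∧ dropLast 2 y ∈ K}, hKbc, hKbball,
      fun x hx => uN_vN_eq_of_not_mem hMdef hNK hP₀ hnN huN hvN hx⟩,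
    fun x => (fderiv_uN_vN_single_three hNs hMdef hεN hP₀ hC hpar1 hnN huN hvN x).1,
    fun x => (fderiv_uN_vN_single_three hNs hMdef hεN hP₀ hC hpar1 hnN huN hvN x).2,
    fun x hu0 hv0 => exists_adaptedChart hNs hMdef hcrit hNz₀ hNz₁ hP₀ hnN huN hvN hu0 hv0,
    hxsball, huxs, hvxs, (isMCriticalPt_iff_fderiv q xs).2 hcritxs, hnd, hidx,
    fun x hu hv hcx => eq_of_fderiv_q_eq_zero_of_pos hNs hMdef hK.isClosed hKball
      (by rw [dropLast_two_apply_zero, hqs0]) hNK hεN hcrit hNz₁ hP₀ hC hpar2 hnN huN hvN hq hxs hxs3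
      hu hv ((isMCriticalPt_iff_fderiv q x).1 hcx),
    fun x hju hjv hcx => ?_, fun x hlu hlv hcx => ?_, ?_, ?_, ?_, ?_, ?_, ?_, ?_⟩
  · -- sector `j`
    have hx3 : x 3 < 0 := by have := (uN_sub_vN huN hvN x).1; linarith
    have hwedge : x 3 < nN x := by
      have h1 : uN x < 0 := by linarith
      rw [huN] at h1; linarith
    have hg : ∀ y, (fun x => -((vN x - uN x) * (-uN x))) y = y 3 * (nN y - y 3) / 2 := fun y => by
      show -((vN y - uN y) * (-uN y)) = _; rw [huN, hvN]; ring
    exact no_crit_j hNs hMdef hK.isClosed hKball (by rw [dropLast_two_apply_zero, hqs0]) hNK hεN hcrit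
      hNz₁ hP₀ hC hpar3 hnN hg hx3 hwedge ((isMCriticalPt_iff_fderiv _ x).1 hcx)
  · -- sector `l`
    have hx3 : 0 < x 3 := by have := (uN_sub_vN huN hvN x).1; linarith
    have hwedge : 0 < x 3 + nN x := by
      rw [hvN] at hlu; linarith
    have hg : ∀ y, (fun x => -((-vN x) * (uN x - vN x))) y = -(y 3 * (y 3 + nN y)) / 2 := fun y => by
      show -((-vN y) * (uN y - vN y)) = _; rw [huN, hvN]; ring
    exact no_crit_l hNs hMdef hK.isClosed hKball (by rw [dropLast_two_apply_zero, hqs0]) hNK hεN hcrit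
      hNz₁ hP₀ hC hpar3 hnN hg hx3 hwedge ((isMCriticalPt_iff_fderiv _ x).1 hcx)
  -- ### regularity at face points
  · intro x ha0 hb0 hcx
    have hreg := (fderiv_uN_vN_single_three hNs hMdef hεN hP₀ hC hpar1 hnN huN hvN x).1
    exact fderiv_neg_mul_ne_zero_of_left (huNs.differentiable (by simp)) (hvNs.differentiable (by simp))
      ha0 hb0.ne' (fun h0 => by rw [h0] at hreg; simp at hreg) ((isMCriticalPt_iff_fderiv _ x).1 hcx)
  · intro x hb0 ha0 hcx
    have hreg := (fderiv_uN_vN_single_three hNs hMdef hεN hP₀ hC hpar1 hnN huN hvN x).2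
    exact fderiv_neg_mul_ne_zero_of_right (huNs.differentiable (by simp)) (hvNs.differentiable (by simp))
      hb0 ha0.ne' (fun h0 => by rw [h0] at hreg; simp at hreg) ((isMCriticalPt_iff_fderiv _ x).1 hcx)
  · intro x ha0 hb0 hcx
    have hdiff : fderiv ℝ (fun y => vN y - uN y) x ≠ 0 := by
      have hfun : (fun y => vN y - uN y) = fun y : EuclideanSpace ℝ (Fin 4) => -y 3 := by
        funext y; have := (uN_sub_vN huN hvN y).1; linarith
      rw [hfun]
      have hd : HasFDerivAt (fun y : EuclideanSpace ℝ (Fin 4) => -y 3)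
          (-(EuclideanSpace.proj (3 : Fin 4) : EuclideanSpace ℝ (Fin 4) →L[ℝ] ℝ)) x :=
        (EuclideanSpace.proj (3 : Fin 4) : EuclideanSpace ℝ (Fin 4) →L[ℝ] ℝ).hasFDerivAt.neg
      rw [hd.fderiv]
      intro h0
      have := congrArg (fun L : EuclideanSpace ℝ (Fin 4) →L[ℝ] ℝ => L (EuclideanSpace.single 3 1)) h0
      simp at this
    exact fderiv_neg_mul_ne_zero_of_left ((hvNs.sub huNs).differentiable (by simp))
      (huNs.neg.differentiable (by simp)) ha0 hb0.ne' hdiff ((isMCriticalPt_iff_fderiv _ x).1 hcx)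
  · intro x hb0 ha0 hcx
    have hreg := (fderiv_uN_vN_single_three hNs hMdef hεN hP₀ hC hpar1 hnN huN hvN x).1
    have hdiff : fderiv ℝ (fun y => -uN y) x ≠ 0 := by
      have hd : HasFDerivAt (fun y => -uN y) (-fderiv ℝ uN x) x :=
        ((huNs.differentiable (by simp)) x).hasFDerivAt.neg
      rw [hd.fderiv]
      intro h0
      have : fderiv ℝ uN x = 0 := neg_eq_zero.1 h0
      rw [this] at hreg; simp at hreg
    exact fderiv_neg_mul_ne_zero_of_right ((hvNs.sub huNs).differentiable (by simp))
      (huNs.neg.differentiable (by simp)) hb0 ha0.ne' hdiff ((isMCriticalPt_iff_fderiv _ x).1 hcx)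
  · intro x ha0 hb0 hcx
    have hreg := (fderiv_uN_vN_single_three hNs hMdef hεN hP₀ hC hpar1 hnN huN hvN x).2
    have hdiff : fderiv ℝ (fun y => -vN y) x ≠ 0 := by
      have hd : HasFDerivAt (fun y => -vN y) (-fderiv ℝ vN x) x :=
        ((hvNs.differentiable (by simp)) x).hasFDerivAt.neg
      rw [hd.fderiv]
      intro h0
      have : fderiv ℝ vN x = 0 := neg_eq_zero.1 h0
      rw [this] at hreg; simp at hreg
    exact fderiv_neg_mul_ne_zero_of_left (hvNs.neg.differentiable (by simp))
      ((huNs.sub hvNs).differentiable (by simp)) ha0 hb0.ne' hdiff ((isMCriticalPt_iff_fderiv _ x).1 hcx)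
  · intro x hb0 ha0 hcx
    have hdiff : fderiv ℝ (fun y => uN y - vN y) x ≠ 0 := by
      have hfun : (fun y => uN y - vN y) = fun y : EuclideanSpace ℝ (Fin 4) => y 3 := by
        funext y; exact (uN_sub_vN huN hvN y).1
      rw [hfun]
      have hd : HasFDerivAt (fun y : EuclideanSpace ℝ (Fin 4) => y 3)
          (EuclideanSpace.proj (3 : Fin 4) : EuclideanSpace ℝ (Fin 4) →L[ℝ] ℝ) x :=
        (EuclideanSpace.proj (3 : Fin 4) : EuclideanSpace ℝ (Fin 4) →L[ℝ] ℝ).hasFDerivAt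
      rw [hd.fderiv]
      intro h0
      have := congrArg (fun L : EuclideanSpace ℝ (Fin 4) →L[ℝ] ℝ => L (EuclideanSpace.single 3 1)) h0
      simp at this
    exact fderiv_neg_mul_ne_zero_of_right (hvNs.neg.differentiable (by simp))
      ((huNs.sub hvNs).differentiable (by simp)) hb0 ha0.ne' hdiff ((isMCriticalPt_iff_fderiv _ x).1 hcx)
  -- ### the face data
  · have hslab : ∀ x : EuclideanSpace ℝ (Fin 4), |x 3| ≤ P₀ →
        uN x = (x 3 - N (dropLast 2 x)) / 2 ∧ vN x = (-x 3 - N (dropLast 2 x)) / 2 := by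
      intro x hx
      have hθ : θR P₀ (x 3) = 1 := θR_eq_one hP₀ hx
      rw [huN, hvN, hnN, hθ, one_mul, hMdef, dropLast_two_apply_zero]
      constructor <;> ring
    have hsmall : ∀ x : EuclideanSpace ℝ (Fin 4), dropLast 2 x ∈ K → |x 0| + |N (dropLast 2 x) - x 0| < P₀ := by
      intro x hxK
      have h1 : |(dropLast 2 x) 0| < r :=
        abs_apply_zero_lt_of_mem hKball (by rw [dropLast_two_apply_zero, hqs0]) hxK
      rw [dropLast_two_apply_zero] at h1
      have h2 : |N (dropLast 2 x) - x 0| < ε := by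
        have := hεN (dropLast 2 x); rwa [dropLast_two_apply_zero] at this
      have h3 : r + ε ≤ 3 * R / 16 := by rw [hrdef]; linarith
      rw [hP₀def]; linarith
    have hfaces : ∀ x : EuclideanSpace ℝ (Fin 4), uN x = 0 ∨ vN x = 0 → dropLast 2 x ∈ K → |x 3| < P₀ := by
      intro x hx hxK
      have hb := hsmall x hxK
      have hM : |M (dropLast 2 x)| = |N (dropLast 2 x) - x 0| := by rw [hMdef, dropLast_two_apply_zero]
      have hθ : |θR P₀ (x 3)| ≤ 1 := abs_θR_le_one _
      have hprod : |θR P₀ (x 3) * M (dropLast 2 x)| ≤ |N (dropLast 2 x) - x 0| := by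
        rw [abs_mul, ← hM]; exact mul_le_of_le_one_left (abs_nonneg _) hθ
      rcases hx with h0 | h0
      · rw [huN] at h0
        have hx3 : x 3 = x 0 + θR P₀ (x 3) * M (dropLast 2 x) := by rw [hnN] at h0; linarith
        rw [hx3]
        calc |x 0 + θR P₀ (x 3) * M (dropLast 2 x)| ≤ |x 0| + |θR P₀ (x 3) * M (dropLast 2 x)| := abs_add_le _ _
          _ ≤ |x 0| + |N (dropLast 2 x) - x 0| := by linarith
          _ < P₀ := hb
      · rw [hvN] at h0
        have hx3 : x 3 = -(x 0 + θR P₀ (x 3) * M (dropLast 2 x)) := by rw [hnN] at h0; linarith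
        rw [hx3, abs_neg]
        calc |x 0 + θR P₀ (x 3) * M (dropLast 2 x)| ≤ |x 0| + |θR P₀ (x 3) * M (dropLast 2 x)| := abs_add_le _ _
          _ ≤ |x 0| + |N (dropLast 2 x) - x 0| := by linarith
          _ < P₀ := hb
    have hgraph : ∀ x : EuclideanSpace ℝ (Fin 4), |N (dropLast 2 x)| < P₀ → dropLast 2 x ∈ K →
        snocEquiv 3 (dropLast 2 x, N (dropLast 2 x)) ∈ ball qs R := by
      intro x hN3 hxK
      apply hKbball
      refine ⟨?_, ?_⟩
      · show |snocEquiv 3 (dropLast 2 x, N (dropLast 2 x)) 3| ≤ 3 / 2 * P₀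
        rw [show (3 : Fin 4) = Fin.last 3 from rfl, snocEquiv_apply_last]
        linarith [hN3.le]
      · show dropLast 2 (snocEquiv 3 (dropLast 2 x, N (dropLast 2 x))) ∈ K
        rw [dropLast_snocEquiv]; exact hxK
    exact ⟨N, K, P₀, z₀, z₁, hP₀, hK, hN, hNK, hcrit, hz₀₁, hi₀, hi₁, hNz₀, hNz₁, hxs, hxs3, hslab, hsmall,
      hfaces, hgraph⟩


end Implant

end Literature.Topology.FourManifolds
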